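import Literature.Computability.AlgebraicComplexity.CKSV22GeneralABPLowerBound
import Literature.Computability.AlgebraicComplexity.CKSV22EsymRobustBounds
import Literature.Computability.AlgebraicComplexity.CKSV22EsymABPLowerBound
import Literature.Computability.AlgebraicComplexity.CKSV22HomogeneousSingularLocusBounds
import HarnessLib

/-!
# CKSV 2022, Theorem 1.1 for an arbitrary polynomial with a robust singular-locus bound, and for `ESYM` (§1.5 remark)

P. Chatterjee, M. Kumar, A. She, B. L. Volk, *Quadratic lower bounds for algebraic branching programs
and formulas*, comput. complex. **31** (2022) 8 (arXiv:1911.11793), §1.5 (TeX L205; held arXiv text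
`paper:arxiv-1911.11793` p0007.txt:L4–5): "We remark that
the lower bound in Theorem 1.1 also holds for elementary symmetric polynomials of degree `0.1n` on
`n` variables. … In general, these lower bounds hold for any family of polynomials of high enough
degree whose zeroes of multiplicity at least two lie in a low dimensional variety, or more formally,
an analog of Claim 9 or Lemma 24 is true."

The tree's `chatterjeeKumarSheVolk2022_thm_1_1` (file `CKSV22GeneralABPLowerBound`, LAYERED ABPs of
Definition 1 with labels of degree `≤ Δ`) is proved for `Σ x_iⁿ` by the depth reduction
`CKSV2022.depthReduction` followed by the power-sum width lemma. This file re-runs that proof for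
an arbitrary `f` of total degree `d` with the width lemma replaced by the robust counting step
`CKSV2022.le_two_mul_card_of_eq_sum_mul_add` (assembled in this tree; the printed remark has no
proof):

* `CKSV2022.thm_1_1_of_robustHeight` — if `deg f = d` and for all `g_i` of degree `≤ d − 2` every
  prime `⊇ (∂_i f − g_i : i)` has height `≥ c`, then a layered ABP on at most `m` vertices with labels
  of degree `≤ Δ` computing `f` has `c·(⌊d/Δ⌋ − 1) ≤ 18·(m − 2)`.
* `CKSV2022.thm_1_1_of_isHomogeneous` — the same for `f` homogeneous of degree `d ≥ 2` from the
  plain bound "every prime `⊇ (∂_i f)` has height `≥ c`" (Lemma 25).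
* `CKSV2022.chatterjeeKumarSheVolk2022_thm_1_1_esymm` — **the §1.5 remark itself**: a layered ABP
  with labels of degree `≤ Δ` computing `e_{n,d}` (`2 ≤ d ≤ n`, `1, …, n ≠ 0` in `K`) has
  `(n − (d−2))·(⌊d/Δ⌋ − 1) ≤ 18·(m − 2)`; at `d = 0.1n`, `Δ = 1`: `m ≥ 2 + 0.9n(0.1n − 1)/18 = Ω(n²)`.

D-0026: no named facts, no definitions.

## References
* [ChatterjeeKumarSheVolk2022] — Theorem 1.1 (proof, §3.2), §1.5 (remark), Lemma 24, Lemma 25.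
-/

noncomputable section

open MvPolynomial Matrix Finset

namespace Literature.Computability.AlgebraicComplexity

namespace CKSV2022

variable {K : Type*} [Field K]

/-- **CKSV Thm. 1.1 for an arbitrary `f` under a robust singular-locus bound** (layered ABPs,
labels of degree `≤ Δ`): `c·(⌊d/Δ⌋ − 1) ≤ 18·(m − 2)` where `d = deg f`. Proof = the tree's proof
of `chatterjeeKumarSheVolk2022_thm_1_1` (one component `exists_comp_of_layered`, depth reduction
`depthReduction` down to `L'Δ < d`, error count `r ≤ 9T/q`) with the robust counting step
`le_two_mul_card_of_eq_sum_mul_add` (`c ≤ 2r`) in place of the power-sum width lemma. Assembled in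
this tree. [cite: ChatterjeeKumarSheVolk2022, Theorem 1.1 (proof) and §1.5 (remark)] -/
theorem thm_1_1_of_robustHeight {n d m Δ c : ℕ} {f : MvPolynomial (Fin n) K}
    (hfd : f.totalDegree = d)
    (hc : ∀ g : Fin n → MvPolynomial (Fin n) K, (∀ i, (g i).totalDegree ≤ d - 2) →
      ∀ 𝔭 : Ideal (MvPolynomial (Fin n) K), 𝔭.IsPrime → (∀ i, pderiv i f - g i ∈ 𝔭) →
        (c : ℕ∞) ≤ 𝔭.height)
    (h : LayeredABPDegComputes m Δ f) : c * (d / Δ - 1) ≤ 18 * (m - 2) := by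
  classical
  by_cases hsmall' : d / Δ ≤ 1
  · rw [show d / Δ - 1 = 0 by omega, mul_zero]; exact Nat.zero_le _
  have hsmall : 1 < d / Δ := not_le.1 hsmall'
  have hΔ : 1 ≤ Δ := by
    rcases Nat.eq_zero_or_pos Δ with h0 | h0
    · rw [h0, Nat.div_zero] at hsmall; omega
    · exact h0
  have hn : 2 * Δ ≤ d := by
    have h1 := Nat.div_mul_le_self d Δ
    have h2 : 2 * Δ ≤ d / Δ * Δ := Nat.mul_le_mul_right _ hsmall
    omega
  obtain ⟨k, hk, layer, s, t, N, hlay, hdeg, hcomp⟩ := h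
  -- the end vertex lies `D ≥ 1` layers above the start (else the computed polynomial is constant)
  have hD : 1 ≤ layer t - layer s := by
    by_contra h0
    rw [show layer t - layer s = 0 by omega, pow_zero] at hcomp
    have h1 : f.totalDegree = 0 := by
      rw [← hcomp, Matrix.one_apply]
      split_ifs
      · exact totalDegree_one
      · exact totalDegree_zero
    omega
  obtain ⟨cp, hcD, hcp, hck⟩ := exists_comp_of_layered layer s t N hlay hdeg hD
  rw [hcomp] at hcp
  -- depth reduction of the one-component multilayered ABP, to depth `L'` with `L'Δ < d`
  obtain ⟨r, ρ, _, P, Q, c₀, ι', _, A', L', hr, hA'L', hL'n, hP, hQ, hev, hstop, hgo⟩ :=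
    depthReduction (σ := Fin n) (K := K) d cp.internal hΔ hn cp.D (ι := Unit) (fun _ => cp)
      (fun _ => le_rfl) (by simp)
  -- the robust counting step: `c ≤ 2r`
  have hwidth : c ≤ 2 * r := by
    have hP' : (∑ i, (A' i).eval + C c₀).totalDegree < d := by
      refine lt_of_le_of_lt (totalDegree_add _ _) (max_lt ?_ ?_)
      · exact lt_of_le_of_lt (totalDegree_finsetSum _ _) (lt_of_le_of_lt (Finset.sup_le fun i _ =>
          ((A' i).totalDegree_eval_le.trans (Nat.mul_le_mul_right _ (hA'L' i)))) hL'n)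
      · rw [totalDegree_C]; omega
    have key : f = ∑ x, P x * Q x + (∑ i, (A' i).eval + C c₀) := by
      rw [← hcp]
      have h1 : ∑ _i : Unit, cp.eval = cp.eval := by simp
      rw [h1] at hev
      rw [hev]; ring
    rw [← hr]
    exact le_two_mul_card_of_eq_sum_mul_add hc P Q hP hQ _ hP' key
  -- the error count
  by_cases hDn : cp.D * Δ < d
  · have h0 : r = 0 := hstop hDn
    rw [h0, mul_zero] at hwidth
    rw [Nat.le_zero.1 hwidth, zero_mul]
    exact Nat.zero_le _
  · have hgo' := hgo (not_lt.1 hDn)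
    have hD2 : 2 ≤ cp.D := by
      by_contra h0
      have : cp.D * Δ ≤ 1 * Δ := Nat.mul_le_mul_right _ (by omega)
      omega
    have h1 : r * (d / Δ - 1) * (cp.D - 1) ≤ 9 * cp.internal * (cp.D - 1) :=
      le_trans (Nat.le_add_right _ _) hgo'
    have h2 : r * (d / Δ - 1) ≤ 9 * cp.internal := Nat.le_of_mul_le_mul_right h1 (by omega)
    have h3 : cp.internal ≤ m - 2 := by omega
    calc c * (d / Δ - 1) ≤ 2 * r * (d / Δ - 1) := Nat.mul_le_mul_right _ hwidth
      _ = 2 * (r * (d / Δ - 1)) := by ring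
      _ ≤ 2 * (9 * cp.internal) := Nat.mul_le_mul_left _ h2
      _ = 18 * cp.internal := by ring
      _ ≤ 18 * (m - 2) := Nat.mul_le_mul_left _ h3

/-- **CKSV Thm. 1.1 for a homogeneous `f` from `codim 𝕍(∂f) ≥ c` alone** (Lemma 25 supplies the
robustness): `f ≠ 0` homogeneous of degree `d ≥ 2`, every prime `⊇ (∂_i f)` of height `≥ c` ⟹ a
layered ABP on at most `m` vertices with labels of degree `≤ Δ` computing `f` has
`c·(⌊d/Δ⌋ − 1) ≤ 18·(m − 2)`. Assembled in this tree.
[cite: ChatterjeeKumarSheVolk2022, Theorem 1.1 and §1.5 (remark)] -/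
theorem thm_1_1_of_isHomogeneous {n d m Δ c : ℕ} (hd : 2 ≤ d) {f : MvPolynomial (Fin n) K}
    (hf : f.IsHomogeneous d) (hf0 : f ≠ 0)
    (hc : ∀ P : Ideal (MvPolynomial (Fin n) K), P.IsPrime → (∀ i, pderiv i f ∈ P) →
      (c : ℕ∞) ≤ P.height)
    (h : LayeredABPDegComputes m Δ f) : c * (d / Δ - 1) ≤ 18 * (m - 2) :=
  thm_1_1_of_robustHeight (hf.totalDegree hf0) (robustHeight_of_isHomogeneous hd hf hc) h

/-- **CKSV 2022, §1.5 remark: Theorem 1.1 for `ESYM(n,d)`** ("the lower bound in Theorem 1.1 also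
holds for elementary symmetric polynomials of degree `0.1n` on `n` variables"), explicit and for
every degree: a layered ABP on at most `m` vertices with labels of degree `≤ Δ` computing `e_{n,d}`
(`2 ≤ d ≤ n`, `1, …, n ≠ 0` in `K`) has `(n − (d−2))·(⌊d/Δ⌋ − 1) ≤ 18·(m − 2)`. Assembled in this
tree: `thm_1_1_of_robustHeight` + Lemma 24. Locator of the remark: held arXiv text p0007.txt:L4–5.
[cite: ChatterjeeKumarSheVolk2022, §1.5 (remark), Theorem 1.1] -/
theorem chatterjeeKumarSheVolk2022_thm_1_1_esymm {n d m Δ : ℕ} (hd : 2 ≤ d) (hdn : d ≤ n)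
    (hK : ∀ j : ℕ, 1 ≤ j → j ≤ n → (j : K) ≠ 0)
    (h : LayeredABPDegComputes m Δ (esymm (Fin n) K d)) :
    (n - (d - 2)) * (d / Δ - 1) ≤ 18 * (m - 2) :=
  thm_1_1_of_robustHeight (totalDegree_esymm (K := K) hdn) (lemma_24_height hd hdn hK) h

/-- The affine-label case (`Δ = 1`, the tree's `LayeredABPComputes`): `(n − (d−2))·(d − 1) ≤ 18(m − 2)`
for layered ABPs computing `e_{n,d}`. [cite: ChatterjeeKumarSheVolk2022, §1.5 (remark), Theorem 1.1] -/
theorem chatterjeeKumarSheVolk2022_thm_1_1_esymm_affine {n d m : ℕ} (hd : 2 ≤ d) (hdn : d ≤ n)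
    (hK : ∀ j : ℕ, 1 ≤ j → j ≤ n → (j : K) ≠ 0)
    (h : LayeredABPComputes m (esymm (Fin n) K d)) :
    (n - (d - 2)) * (d - 1) ≤ 18 * (m - 2) := by
  have := chatterjeeKumarSheVolk2022_thm_1_1_esymm hd hdn hK
    ((layeredABPComputes_iff_layeredABPDegComputes_one m _).1 h)
  rwa [Nat.div_one] at this

end CKSV2022

end Literature.Computability.AlgebraicComplexity

end
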